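import Summits.BirchSwinnertonDyer.BirchSwinnertonDyer.Theorems.KolyvaginDepthDoorDepthTablePointCert
import HarnessLib

/-!
# Route `KolyvaginDepthDoor` — the depth table in POINT-CERTIFICATE form, part 2: the test is exact,
# and rows 7–18 (`655a1 … 997c1`; crux `KolyvaginDepthSupply`, stmt-BirchSwinnertonDyer-21765)

Helper file (`--supports stmt-BirchSwinnertonDyer-21765 --as helper`); it closes nothing and BSD is
not proved by it. Sequel of `KolyvaginDepthDoorDepthTablePointCert` (module docstring there).
§0: the Jetchev–Lauter–Stein test is EXACTLY the row bit — for a tower `d m` (`m ∣ n`) of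
Kolyvagin–Heegner data on one frame, `c_M(n) ≠ 0 ⟺ P(n) ∉ p^M·E(K[n])` at every level `M ≤ M(q)`,
`q ∣ n` (`kolyvaginClass_ne_zero_iff_not_pDiv_of_tower`: McCallum Cor. 4.5 both ways, admissibility
from `ρ̄_{E,p}` onto by Gross Lemma 4.3, invariance from the Euler-system relations, Gross Prop. 3.6;
`…_of_intModel_certificate` at `M = 1` on the row kit's integer-model certificates) — so a
`p`-divisible `P(ℓ)` means `c_1(ℓ) = 0` and the instrument loses nothing. §1: for each remaining
depth-table curve at its `(p, d_K, ℓ)` (g2's row files; every side condition a kernel theorem),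
`P(ℓ) ∉ p·E(K[ℓ])` ⟹ the row's bit `c_1(ℓ) ≠ 0` (`C<label>.kolyvaginClass_ne_zero_of_tower`); feed it
to `C<label>.depthRow_p_negD_ℓ` or `C<label>.kolyvaginDepthSupply_clause` (modulo Kolyvagin 1991 Thm. 4
only). Rows here: `655a1 (7,−51,83)`, `664a1 (5,−39,29)`, `681c1 (5,−83,19)`, `707a1 (5,−19,179)`,
`709a1 (5,−7,409)`, `718b1 (5,−7,59)`, `794a1 (5,−23,89)`, `817a1 (5,−8,239)`, `916c1 (5,−111,19)`,
`944e1 (5,−31,239)`, `997b1 (5,−52,199)`, `997c1 (5,−67,229)`. Per-curve; CONDITIONAL on the computed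
point certificate; BSD is not proved by it.

References: [JetchevLauterStein2009] arXiv:0707.0032 §3.2, §3.6; [McCallumLMS1991] §4 Cor. 4.5, §5;
[GrossLMS1991] Prop. 3.6, Lemma 4.3; [Kolyvagin1991MathAnn] §2 Thm. 4; [WZhang2014] Notations (xii);
[CremonaAlgorithms1997] Table 1.
-/

set_option linter.dupNamespace false

noncomputable section

open scoped Classical NumberField

namespace Summit.BirchSwinnertonDyer.BirchSwinnertonDyer.Theorems.KolyvaginDepthDoor

open Literature.NumberTheory.EllipticCurves Literature.NumberTheory.EllipticCurves.ModularForms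
  WeierstrassCurve
open Summit.BirchSwinnertonDyer.BirchSwinnertonDyer.Rank2Observatory
open Summit.BirchSwinnertonDyer.BirchSwinnertonDyer.Rank1Residual
open Summit.BirchSwinnertonDyer.Rank1Residual.X11b Summit.BirchSwinnertonDyer.Rank1Residual.X11b.Three

/-! ## §0 The test is EXACT: for a tower, `c_M(ℓ) ≠ 0 ⟺ P(ℓ) ∉ p^M·E(K[ℓ])`, any level `M ≤ M(ℓ)` -/

/-- **The JLS test is exactly the row bit, at every admissible level.** `W/ℚ` globally minimal; `p` odd
with `ρ̄_{E,p}` onto; `K` imaginary quadratic, Heegner for `N_E`, `d_K < −4`; `n` a square-free product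
of Kolyvagin primes with `M ≤ M(q)` at each `q ∣ n`; Kolyvagin–Heegner data `d m` at the divisors
`m ∣ n` of one frame. Then `c_M(n) ≠ 0 ⟺ P(n) ∉ p^M·E(K[n])`: McCallum Cor. 4.5 both ways
(`KolyCert.kolyvaginClass_ne_zero_iff`), its two standing inputs supplied — admissibility of
`E(K[n]) ⊆ E(K̄)` for `p^M` from `ρ̄` onto (Gross Lemma 4.3, `RingClassNoTorsion.isAdmissible_pointsSubgroup`)
and `Γ_K`-invariance of `[P(n)]` mod `p^M` from the Euler-system relations on the tower (Gross Prop. 3.6,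
`KolyCert.toGeomPoints_derivedPoint_mem_invPoints_of_dvd_zhang`). So the instrument loses nothing: a
`p^M`-DIVISIBLE `P(n)` means `c_M(n) = 0`. [cite: JetchevLauterStein2009, §3.2 (arXiv:0707.0032)]
[cite: McCallumLMS1991, §4 (4)–(5) and Cor. 4.5] [cite: GrossLMS1991, Prop. 3.6 and Lemma 4.3] -/
theorem kolyvaginClass_ne_zero_iff_not_pDiv_of_tower (W : WeierstrassCurve ℚ) [W.IsElliptic]
    [W.IsGloballyMinimal] [NeZero (W.conductorNorm ℤ)] (K : Type) [Field K] [NumberField K]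
    (Dt : ModularParametrizationData W (W.conductorNorm ℤ)) (β : ℤ) (ι : K →+* ℂ)
    (p : ℕ) [hp : Fact p.Prime] (hp2 : p ≠ 2) (hsurj : W.HasSurjectiveModNGaloisRep p)
    (hK : IsImaginaryQuadratic K) (hH : SatisfiesHeegnerHypothesis (W.conductorNorm ℤ) K)
    (hD : NumberField.discr K < -4) {n M : ℕ} (hn : Squarefree n)
    (hkol : ∀ q ∈ n.primeFactors, Zhang2014.IsKolyvaginPrime (W.conductorNorm ℤ) W K p q ∧
      M ≤ Zhang2014.kolyvaginIndex W p q)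
    (d : (m : ℕ) → m ∣ n → KolyvaginHeegnerData Dt β ι m) :
    (d n dvd_rfl).kolyvaginClass hp.out M ≠ 0 ↔ ¬ Koly.PDiv (d n dvd_rfl) p M := by
  have hND : IsCoprime (W.conductorNorm ℤ : ℤ) (NumberField.discr K) := by
    have h := Literature.SatisfiesHeegnerHypothesis.coprime_discr hK.1 hH
    refine Int.isCoprime_iff_gcd_eq_one.mpr ?_
    rw [Int.gcd_eq_natAbs, Int.natAbs_natCast]
    exact h
  have hP := KolyCert.toGeomPoints_derivedPoint_mem_invPoints_of_dvd_zhang hK ι Dt hp.out hND hD hn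
    hkol d n dvd_rfl
  have hA := RingClassNoTorsion.isAdmissible_pointsSubgroup (d n dvd_rfl) hK hn.ne_zero hp.out hp2
    hsurj M
  rw [KolyCert.kolyvaginClass_ne_zero_iff (d n dvd_rfl) hp.out M]
  exact ⟨fun h ↦ h.2.2, fun h ↦ ⟨hA, hP, h⟩⟩

section Generic

variable {W : WeierstrassCurve ℚ} [W.IsElliptic] [W.IsGloballyMinimal] {E₀ : WeierstrassCurve ℤ}
  (hI : integralModelInt W = E₀)
include hI

/-- **The same on integer-model certificates, level `M = 1`** (the depth table's level): with the row
kit's inputs (`ρ̄_{E,p}` onto, `d_K = D < −4` Heegner for `N_E` by Kronecker symbols at the primes of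
`Δ(E₀)`, `ℓ` a Kolyvagin prime read off `#(E₀ mod ℓ)(𝔽_ℓ)`), for a tower `d m` (`m ∣ ℓ`):
`c_1(ℓ) ≠ 0 ⟺ P(ℓ) ∉ p·E(K[ℓ])`. [cite: JetchevLauterStein2009, §3.2 (arXiv:0707.0032)]
[cite: McCallumLMS1991, Cor. 4.5] -/
theorem kolyvaginClass_ne_zero_iff_not_pDiv_of_intModel_certificate
    (p : ℕ) [hp : Fact p.Prime] (hp2 : p ≠ 2) (hsurj : W.HasSurjectiveModNGaloisRep p)
    (K : Type) [Field K] [NumberField K] (hK : IsImaginaryQuadratic K) {D : ℤ}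
    (hD : NumberField.discr K = D) (hD4 : D < -4)
    (hH : ∀ q : ℕ, q.Prime → (q : ℤ) ∣ E₀.Δ → (q = 2 → D % 8 = 1) ∧ (q ≠ 2 → jacobiSym D q = 1))
    (ℓ : ℕ) (hℓ : ℓ.Prime) (hℓ2 : ℓ ≠ 2) (hℓΔ : ¬ (ℓ : ℤ) ∣ E₀.Δ) (hℓD : ¬ (ℓ : ℤ) ∣ D)
    (hℓp : ℓ ≠ p) (hjac : jacobiSym D ℓ = -1) (hℓ1 : p ∣ ℓ + 1) {n : ℕ}
    (hcard : Nat.card ((E₀.map (Int.castRingHom (ZMod ℓ))).toAffine.Point) = n)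
    (haℓ : (p : ℤ) ∣ (ℓ : ℤ) + 1 - n)
    [NeZero (W.conductorNorm ℤ)] (Dt : ModularParametrizationData W (W.conductorNorm ℤ)) (β : ℤ)
    (ι : K →+* ℂ) (d : (m : ℕ) → m ∣ ℓ → KolyvaginHeegnerData Dt β ι m) :
    (d ℓ dvd_rfl).kolyvaginClass hp.out 1 ≠ 0 ↔ ¬ Koly.PDiv (d ℓ dvd_rfl) p 1 := by
  obtain ⟨hkol, -⟩ := isKolyvaginPrime_of_intModel_certificate hI p K hK.1 hD ℓ hℓ hℓ2 hℓΔ hℓD hℓp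
    hjac hℓ1 hcard haℓ
  refine kolyvaginClass_ne_zero_iff_not_pDiv_of_tower W K Dt β ι p hp2 hsurj hK
    (satisfiesHeegnerHypothesis_conductorNorm_of_intModel hI K hK.1 hD hH) (by rw [hD]; exact hD4)
    hℓ.squarefree (fun q hq ↦ ?_) d
  rw [hℓ.primeFactors, Finset.mem_singleton] at hq
  subst hq
  exact ⟨hkol, hkol.2.2.2.2.2⟩

end Generic
/-! ## §1 Depth-table rows 7–18: point certificate ⟹ the row's bit `c_1(ℓ) ≠ 0` -/
namespace C655a1

/-- **Row `655a1` `(7, -51, 83)`, point-certificate form:** for a tower `d m` (`m ∣ 83`) on a frame,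
`P(83) ∉ 7·E(K[83])` ⟹ `c_1(83) ≠ 0`, the bit of `C655a1.depthRow_7_neg51_83` (side conditions: row files).
[cite: JetchevLauterStein2009, §3.2 and §3.6 (arXiv:0707.0032)] [cite: McCallumLMS1991, §4 Cor. 4.5] -/
theorem kolyvaginClass_ne_zero_of_tower (K : Type) [Field K] [NumberField K]
    (hK : IsImaginaryQuadratic K) (hD : NumberField.discr K = -51) :
    haveI := isElliptic_c655a1;
    haveI := isGloballyMinimal_c655a1;
    haveI : NeZero (((⟨0, 0, 1, -13, 18⟩ : WeierstrassCurve ℤ).map (Int.castRingHom ℚ)).conductorNorm ℤ) := neZero_conductorNorm_of_isElliptic _;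
    ∀ (Dt : ModularParametrizationData ((⟨0, 0, 1, -13, 18⟩ : WeierstrassCurve ℤ).map (Int.castRingHom ℚ)) (((⟨0, 0, 1, -13, 18⟩ : WeierstrassCurve ℤ).map (Int.castRingHom ℚ)).conductorNorm ℤ)) (β : ℤ)
    (ι : K →+* ℂ) (d : (m : ℕ) → m ∣ 83 → KolyvaginHeegnerData Dt β ι m),
    ¬ Koly.PDiv (d 83 dvd_rfl) 7 1 → (d 83 dvd_rfl).kolyvaginClass (p := 7) (by norm_num) 1 ≠ 0 := by
  haveI := isElliptic_c655a1
  haveI := isGloballyMinimal_c655a1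
  haveI : NeZero (((⟨0, 0, 1, -13, 18⟩ : WeierstrassCurve ℤ).map (Int.castRingHom ℚ)).conductorNorm ℤ) := neZero_conductorNorm_of_isElliptic _
  intro Dt β ι d hcert
  haveI := Fact.mk (by norm_num : Nat.Prime 7)
  exact kolyvaginClass_ne_zero_of_intModel_certificate_of_tower intModel 7 (by norm_num) hasSurjectiveModNGaloisRep_7 K hK
    hD (by norm_num) heegner_neg51 83 (by norm_num) (by norm_num) (by decide +kernel) (by norm_num) (by norm_num) (by norm_num) (by norm_num)
    (n := 70) card_83 (by norm_num) Dt β ι d hcert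

end C655a1
namespace C664a1

/-- **Row `664a1` `(5, -39, 29)`, point-certificate form:** for a tower `d m` (`m ∣ 29`) on a frame,
`P(29) ∉ 5·E(K[29])` ⟹ `c_1(29) ≠ 0`, the bit of `C664a1.depthRow_5_neg39_29` (side conditions: row files).
[cite: JetchevLauterStein2009, §3.2 and §3.6 (arXiv:0707.0032)] [cite: McCallumLMS1991, §4 Cor. 4.5] -/
theorem kolyvaginClass_ne_zero_of_tower (K : Type) [Field K] [NumberField K]
    (hK : IsImaginaryQuadratic K) (hD : NumberField.discr K = -39) :
    haveI := isElliptic_c664a1;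
    haveI := isGloballyMinimal_c664a1;
    haveI : NeZero (((⟨0, 0, 0, -7, 10⟩ : WeierstrassCurve ℤ).map (Int.castRingHom ℚ)).conductorNorm ℤ) := neZero_conductorNorm_of_isElliptic _;
    ∀ (Dt : ModularParametrizationData ((⟨0, 0, 0, -7, 10⟩ : WeierstrassCurve ℤ).map (Int.castRingHom ℚ)) (((⟨0, 0, 0, -7, 10⟩ : WeierstrassCurve ℤ).map (Int.castRingHom ℚ)).conductorNorm ℤ)) (β : ℤ)
    (ι : K →+* ℂ) (d : (m : ℕ) → m ∣ 29 → KolyvaginHeegnerData Dt β ι m),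
    ¬ Koly.PDiv (d 29 dvd_rfl) 5 1 → (d 29 dvd_rfl).kolyvaginClass (p := 5) (by norm_num) 1 ≠ 0 := by
  haveI := isElliptic_c664a1
  haveI := isGloballyMinimal_c664a1
  haveI : NeZero (((⟨0, 0, 0, -7, 10⟩ : WeierstrassCurve ℤ).map (Int.castRingHom ℚ)).conductorNorm ℤ) := neZero_conductorNorm_of_isElliptic _
  intro Dt β ι d hcert
  haveI := Fact.mk (by norm_num : Nat.Prime 5)
  exact kolyvaginClass_ne_zero_of_intModel_certificate_of_tower intModel 5 (by norm_num) hasSurjectiveModNGaloisRep_5 K hK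
    hD (by norm_num) heegner_neg39 29 (by norm_num) (by norm_num) (by decide +kernel) (by norm_num) (by norm_num) (by norm_num) (by norm_num)
    (n := 25) card_29 (by norm_num) Dt β ι d hcert

end C664a1
namespace C681c1

/-- **Row `681c1` `(5, -83, 19)`, point-certificate form:** for a tower `d m` (`m ∣ 19`) on a frame,
`P(19) ∉ 5·E(K[19])` ⟹ `c_1(19) ≠ 0`, the bit of `C681c1.depthRow_5_neg83_19` (side conditions: row files).
[cite: JetchevLauterStein2009, §3.2 and §3.6 (arXiv:0707.0032)] [cite: McCallumLMS1991, §4 Cor. 4.5] -/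
theorem kolyvaginClass_ne_zero_of_tower (K : Type) [Field K] [NumberField K]
    (hK : IsImaginaryQuadratic K) (hD : NumberField.discr K = -83) :
    haveI := isElliptic_c681c1;
    haveI := isGloballyMinimal_c681c1;
    haveI : NeZero (((⟨0, -1, 1, 0, 2⟩ : WeierstrassCurve ℤ).map (Int.castRingHom ℚ)).conductorNorm ℤ) := neZero_conductorNorm_of_isElliptic _;
    ∀ (Dt : ModularParametrizationData ((⟨0, -1, 1, 0, 2⟩ : WeierstrassCurve ℤ).map (Int.castRingHom ℚ)) (((⟨0, -1, 1, 0, 2⟩ : WeierstrassCurve ℤ).map (Int.castRingHom ℚ)).conductorNorm ℤ)) (β : ℤ)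
    (ι : K →+* ℂ) (d : (m : ℕ) → m ∣ 19 → KolyvaginHeegnerData Dt β ι m),
    ¬ Koly.PDiv (d 19 dvd_rfl) 5 1 → (d 19 dvd_rfl).kolyvaginClass (p := 5) (by norm_num) 1 ≠ 0 := by
  haveI := isElliptic_c681c1
  haveI := isGloballyMinimal_c681c1
  haveI : NeZero (((⟨0, -1, 1, 0, 2⟩ : WeierstrassCurve ℤ).map (Int.castRingHom ℚ)).conductorNorm ℤ) := neZero_conductorNorm_of_isElliptic _
  intro Dt β ι d hcert
  haveI := Fact.mk (by norm_num : Nat.Prime 5)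
  exact kolyvaginClass_ne_zero_of_intModel_certificate_of_tower intModel 5 (by norm_num) hasSurjectiveModNGaloisRep_5 K hK
    hD (by norm_num) heegner_neg83 19 (by norm_num) (by norm_num) (by decide +kernel) (by norm_num) (by norm_num) (by norm_num) (by norm_num)
    (n := 25) card_19 (by norm_num) Dt β ι d hcert

end C681c1
namespace C707a1

/-- **Row `707a1` `(5, -19, 179)`, point-certificate form:** for a tower `d m` (`m ∣ 179`) on a frame,
`P(179) ∉ 5·E(K[179])` ⟹ `c_1(179) ≠ 0`, the bit of `C707a1.depthRow_5_neg19_179` (side conditions: row files).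
[cite: JetchevLauterStein2009, §3.2 and §3.6 (arXiv:0707.0032)] [cite: McCallumLMS1991, §4 Cor. 4.5] -/
theorem kolyvaginClass_ne_zero_of_tower (K : Type) [Field K] [NumberField K]
    (hK : IsImaginaryQuadratic K) (hD : NumberField.discr K = -19) :
    haveI := isElliptic_c707a1;
    haveI := isGloballyMinimal_c707a1;
    haveI : NeZero (((⟨0, 1, 1, -12, 12⟩ : WeierstrassCurve ℤ).map (Int.castRingHom ℚ)).conductorNorm ℤ) := neZero_conductorNorm_of_isElliptic _;
    ∀ (Dt : ModularParametrizationData ((⟨0, 1, 1, -12, 12⟩ : WeierstrassCurve ℤ).map (Int.castRingHom ℚ)) (((⟨0, 1, 1, -12, 12⟩ : WeierstrassCurve ℤ).map (Int.castRingHom ℚ)).conductorNorm ℤ)) (β : ℤ)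
    (ι : K →+* ℂ) (d : (m : ℕ) → m ∣ 179 → KolyvaginHeegnerData Dt β ι m),
    ¬ Koly.PDiv (d 179 dvd_rfl) 5 1 → (d 179 dvd_rfl).kolyvaginClass (p := 5) (by norm_num) 1 ≠ 0 := by
  haveI := isElliptic_c707a1
  haveI := isGloballyMinimal_c707a1
  haveI : NeZero (((⟨0, 1, 1, -12, 12⟩ : WeierstrassCurve ℤ).map (Int.castRingHom ℚ)).conductorNorm ℤ) := neZero_conductorNorm_of_isElliptic _
  intro Dt β ι d hcert
  haveI := Fact.mk (by norm_num : Nat.Prime 5)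
  exact kolyvaginClass_ne_zero_of_intModel_certificate_of_tower intModel 5 (by norm_num) hasSurjectiveModNGaloisRep_5 K hK
    hD (by norm_num) heegner_neg19 179 (by norm_num) (by norm_num) (by decide +kernel) (by norm_num) (by norm_num) (by norm_num) (by norm_num)
    (n := 200) card_179 (by norm_num) Dt β ι d hcert

end C707a1
namespace C709a1

/-- **Row `709a1` `(5, -7, 409)`, point-certificate form:** for a tower `d m` (`m ∣ 409`) on a frame,
`P(409) ∉ 5·E(K[409])` ⟹ `c_1(409) ≠ 0`, the bit of `C709a1.depthRow_5_neg7_409` (side conditions: row files).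
[cite: JetchevLauterStein2009, §3.2 and §3.6 (arXiv:0707.0032)] [cite: McCallumLMS1991, §4 Cor. 4.5] -/
theorem kolyvaginClass_ne_zero_of_tower (K : Type) [Field K] [NumberField K]
    (hK : IsImaginaryQuadratic K) (hD : NumberField.discr K = -7) :
    haveI := isElliptic_c709a1;
    haveI := isGloballyMinimal_c709a1;
    haveI : NeZero (((⟨0, -1, 1, -2, 0⟩ : WeierstrassCurve ℤ).map (Int.castRingHom ℚ)).conductorNorm ℤ) := neZero_conductorNorm_of_isElliptic _;
    ∀ (Dt : ModularParametrizationData ((⟨0, -1, 1, -2, 0⟩ : WeierstrassCurve ℤ).map (Int.castRingHom ℚ)) (((⟨0, -1, 1, -2, 0⟩ : WeierstrassCurve ℤ).map (Int.castRingHom ℚ)).conductorNorm ℤ)) (β : ℤ)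
    (ι : K →+* ℂ) (d : (m : ℕ) → m ∣ 409 → KolyvaginHeegnerData Dt β ι m),
    ¬ Koly.PDiv (d 409 dvd_rfl) 5 1 → (d 409 dvd_rfl).kolyvaginClass (p := 5) (by norm_num) 1 ≠ 0 := by
  haveI := isElliptic_c709a1
  haveI := isGloballyMinimal_c709a1
  haveI : NeZero (((⟨0, -1, 1, -2, 0⟩ : WeierstrassCurve ℤ).map (Int.castRingHom ℚ)).conductorNorm ℤ) := neZero_conductorNorm_of_isElliptic _
  intro Dt β ι d hcert
  haveI := Fact.mk (by norm_num : Nat.Prime 5)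
  exact kolyvaginClass_ne_zero_of_intModel_certificate_of_tower intModel 5 (by norm_num) hasSurjectiveModNGaloisRep_5 K hK
    hD (by norm_num) heegner_neg7 409 (by norm_num) (by norm_num) (by decide +kernel) (by norm_num) (by norm_num) (by norm_num) (by norm_num)
    (n := 405) card_409 (by norm_num) Dt β ι d hcert

end C709a1
namespace C718b1

/-- **Row `718b1` `(5, -7, 59)`, point-certificate form:** for a tower `d m` (`m ∣ 59`) on a frame,
`P(59) ∉ 5·E(K[59])` ⟹ `c_1(59) ≠ 0`, the bit of `C718b1.depthRow_5_neg7_59` (side conditions: row files).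
[cite: JetchevLauterStein2009, §3.2 and §3.6 (arXiv:0707.0032)] [cite: McCallumLMS1991, §4 Cor. 4.5] -/
theorem kolyvaginClass_ne_zero_of_tower (K : Type) [Field K] [NumberField K]
    (hK : IsImaginaryQuadratic K) (hD : NumberField.discr K = -7) :
    haveI := isElliptic_c718b1;
    haveI := isGloballyMinimal_c718b1;
    haveI : NeZero (((⟨1, 0, 1, -5, 0⟩ : WeierstrassCurve ℤ).map (Int.castRingHom ℚ)).conductorNorm ℤ) := neZero_conductorNorm_of_isElliptic _;
    ∀ (Dt : ModularParametrizationData ((⟨1, 0, 1, -5, 0⟩ : WeierstrassCurve ℤ).map (Int.castRingHom ℚ)) (((⟨1, 0, 1, -5, 0⟩ : WeierstrassCurve ℤ).map (Int.castRingHom ℚ)).conductorNorm ℤ)) (β : ℤ)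
    (ι : K →+* ℂ) (d : (m : ℕ) → m ∣ 59 → KolyvaginHeegnerData Dt β ι m),
    ¬ Koly.PDiv (d 59 dvd_rfl) 5 1 → (d 59 dvd_rfl).kolyvaginClass (p := 5) (by norm_num) 1 ≠ 0 := by
  haveI := isElliptic_c718b1
  haveI := isGloballyMinimal_c718b1
  haveI : NeZero (((⟨1, 0, 1, -5, 0⟩ : WeierstrassCurve ℤ).map (Int.castRingHom ℚ)).conductorNorm ℤ) := neZero_conductorNorm_of_isElliptic _
  intro Dt β ι d hcert
  haveI := Fact.mk (by norm_num : Nat.Prime 5)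
  exact kolyvaginClass_ne_zero_of_intModel_certificate_of_tower intModel 5 (by norm_num) hasSurjectiveModNGaloisRep_5 K hK
    hD (by norm_num) heegner_neg7 59 (by norm_num) (by norm_num) (by decide +kernel) (by norm_num) (by norm_num) (by norm_num) (by norm_num)
    (n := 55) card_59 (by norm_num) Dt β ι d hcert

end C718b1
namespace C794a1

/-- **Row `794a1` `(5, -23, 89)`, point-certificate form:** for a tower `d m` (`m ∣ 89`) on a frame,
`P(89) ∉ 5·E(K[89])` ⟹ `c_1(89) ≠ 0`, the bit of `C794a1.depthRow_5_neg23_89` (side conditions: row files).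
[cite: JetchevLauterStein2009, §3.2 and §3.6 (arXiv:0707.0032)] [cite: McCallumLMS1991, §4 Cor. 4.5] -/
theorem kolyvaginClass_ne_zero_of_tower (K : Type) [Field K] [NumberField K]
    (hK : IsImaginaryQuadratic K) (hD : NumberField.discr K = -23) :
    haveI := isElliptic_c794a1;
    haveI := isGloballyMinimal_c794a1;
    haveI : NeZero (((⟨1, 0, 1, -3, 2⟩ : WeierstrassCurve ℤ).map (Int.castRingHom ℚ)).conductorNorm ℤ) := neZero_conductorNorm_of_isElliptic _;
    ∀ (Dt : ModularParametrizationData ((⟨1, 0, 1, -3, 2⟩ : WeierstrassCurve ℤ).map (Int.castRingHom ℚ)) (((⟨1, 0, 1, -3, 2⟩ : WeierstrassCurve ℤ).map (Int.castRingHom ℚ)).conductorNorm ℤ)) (β : ℤ)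
    (ι : K →+* ℂ) (d : (m : ℕ) → m ∣ 89 → KolyvaginHeegnerData Dt β ι m),
    ¬ Koly.PDiv (d 89 dvd_rfl) 5 1 → (d 89 dvd_rfl).kolyvaginClass (p := 5) (by norm_num) 1 ≠ 0 := by
  haveI := isElliptic_c794a1
  haveI := isGloballyMinimal_c794a1
  haveI : NeZero (((⟨1, 0, 1, -3, 2⟩ : WeierstrassCurve ℤ).map (Int.castRingHom ℚ)).conductorNorm ℤ) := neZero_conductorNorm_of_isElliptic _
  intro Dt β ι d hcert
  haveI := Fact.mk (by norm_num : Nat.Prime 5)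
  exact kolyvaginClass_ne_zero_of_intModel_certificate_of_tower intModel 5 (by norm_num) hasSurjectiveModNGaloisRep_5 K hK
    hD (by norm_num) heegner_neg23 89 (by norm_num) (by norm_num) (by decide +kernel) (by norm_num) (by norm_num) (by norm_num) (by norm_num)
    (n := 90) card_89 (by norm_num) Dt β ι d hcert

end C794a1
namespace C817a1

/-- **Row `817a1` `(5, -8, 239)`, point-certificate form:** for a tower `d m` (`m ∣ 239`) on a frame,
`P(239) ∉ 5·E(K[239])` ⟹ `c_1(239) ≠ 0`, the bit of `C817a1.depthRow_5_neg8_239` (side conditions: row files).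
[cite: JetchevLauterStein2009, §3.2 and §3.6 (arXiv:0707.0032)] [cite: McCallumLMS1991, §4 Cor. 4.5] -/
theorem kolyvaginClass_ne_zero_of_tower (K : Type) [Field K] [NumberField K]
    (hK : IsImaginaryQuadratic K) (hD : NumberField.discr K = -8) :
    haveI := isElliptic_c817a1;
    haveI := isGloballyMinimal_c817a1;
    haveI : NeZero (((⟨0, 1, 1, 1, 6⟩ : WeierstrassCurve ℤ).map (Int.castRingHom ℚ)).conductorNorm ℤ) := neZero_conductorNorm_of_isElliptic _;
    ∀ (Dt : ModularParametrizationData ((⟨0, 1, 1, 1, 6⟩ : WeierstrassCurve ℤ).map (Int.castRingHom ℚ)) (((⟨0, 1, 1, 1, 6⟩ : WeierstrassCurve ℤ).map (Int.castRingHom ℚ)).conductorNorm ℤ)) (β : ℤ)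
    (ι : K →+* ℂ) (d : (m : ℕ) → m ∣ 239 → KolyvaginHeegnerData Dt β ι m),
    ¬ Koly.PDiv (d 239 dvd_rfl) 5 1 → (d 239 dvd_rfl).kolyvaginClass (p := 5) (by norm_num) 1 ≠ 0 := by
  haveI := isElliptic_c817a1
  haveI := isGloballyMinimal_c817a1
  haveI : NeZero (((⟨0, 1, 1, 1, 6⟩ : WeierstrassCurve ℤ).map (Int.castRingHom ℚ)).conductorNorm ℤ) := neZero_conductorNorm_of_isElliptic _
  intro Dt β ι d hcert
  haveI := Fact.mk (by norm_num : Nat.Prime 5)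
  exact kolyvaginClass_ne_zero_of_intModel_certificate_of_tower intModel 5 (by norm_num) hasSurjectiveModNGaloisRep_5 K hK
    hD (by norm_num) heegner_neg8 239 (by norm_num) (by norm_num) (by decide +kernel) (by norm_num) (by norm_num) (by norm_num) (by norm_num)
    (n := 240) card_239 (by norm_num) Dt β ι d hcert

end C817a1
namespace C916c1

/-- **Row `916c1` `(5, -111, 19)`, point-certificate form:** for a tower `d m` (`m ∣ 19`) on a frame,
`P(19) ∉ 5·E(K[19])` ⟹ `c_1(19) ≠ 0`, the bit of `C916c1.depthRow_5_neg111_19` (side conditions: row files).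
[cite: JetchevLauterStein2009, §3.2 and §3.6 (arXiv:0707.0032)] [cite: McCallumLMS1991, §4 Cor. 4.5] -/
theorem kolyvaginClass_ne_zero_of_tower (K : Type) [Field K] [NumberField K]
    (hK : IsImaginaryQuadratic K) (hD : NumberField.discr K = -111) :
    haveI := isElliptic_c916c1;
    haveI := isGloballyMinimal_c916c1;
    haveI : NeZero (((⟨0, 0, 0, -4, 1⟩ : WeierstrassCurve ℤ).map (Int.castRingHom ℚ)).conductorNorm ℤ) := neZero_conductorNorm_of_isElliptic _;
    ∀ (Dt : ModularParametrizationData ((⟨0, 0, 0, -4, 1⟩ : WeierstrassCurve ℤ).map (Int.castRingHom ℚ)) (((⟨0, 0, 0, -4, 1⟩ : WeierstrassCurve ℤ).map (Int.castRingHom ℚ)).conductorNorm ℤ)) (β : ℤ)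
    (ι : K →+* ℂ) (d : (m : ℕ) → m ∣ 19 → KolyvaginHeegnerData Dt β ι m),
    ¬ Koly.PDiv (d 19 dvd_rfl) 5 1 → (d 19 dvd_rfl).kolyvaginClass (p := 5) (by norm_num) 1 ≠ 0 := by
  haveI := isElliptic_c916c1
  haveI := isGloballyMinimal_c916c1
  haveI : NeZero (((⟨0, 0, 0, -4, 1⟩ : WeierstrassCurve ℤ).map (Int.castRingHom ℚ)).conductorNorm ℤ) := neZero_conductorNorm_of_isElliptic _
  intro Dt β ι d hcert
  haveI := Fact.mk (by norm_num : Nat.Prime 5)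
  exact kolyvaginClass_ne_zero_of_intModel_certificate_of_tower intModel 5 (by norm_num) hasSurjectiveModNGaloisRep_5 K hK
    hD (by norm_num) heegner_neg111 19 (by norm_num) (by norm_num) (by decide +kernel) (by norm_num) (by norm_num) (by norm_num) (by norm_num)
    (n := 25) card_19 (by norm_num) Dt β ι d hcert

end C916c1
namespace C944e1

/-- **Row `944e1` `(5, -31, 239)`, point-certificate form:** for a tower `d m` (`m ∣ 239`) on a frame,
`P(239) ∉ 5·E(K[239])` ⟹ `c_1(239) ≠ 0`, the bit of `C944e1.depthRow_5_neg31_239` (side conditions: row files).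
[cite: JetchevLauterStein2009, §3.2 and §3.6 (arXiv:0707.0032)] [cite: McCallumLMS1991, §4 Cor. 4.5] -/
theorem kolyvaginClass_ne_zero_of_tower (K : Type) [Field K] [NumberField K]
    (hK : IsImaginaryQuadratic K) (hD : NumberField.discr K = -31) :
    haveI := isElliptic_c944e1;
    haveI := isGloballyMinimal_c944e1;
    haveI : NeZero (((⟨0, 0, 0, -19, 34⟩ : WeierstrassCurve ℤ).map (Int.castRingHom ℚ)).conductorNorm ℤ) := neZero_conductorNorm_of_isElliptic _;
    ∀ (Dt : ModularParametrizationData ((⟨0, 0, 0, -19, 34⟩ : WeierstrassCurve ℤ).map (Int.castRingHom ℚ)) (((⟨0, 0, 0, -19, 34⟩ : WeierstrassCurve ℤ).map (Int.castRingHom ℚ)).conductorNorm ℤ)) (β : ℤ)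
    (ι : K →+* ℂ) (d : (m : ℕ) → m ∣ 239 → KolyvaginHeegnerData Dt β ι m),
    ¬ Koly.PDiv (d 239 dvd_rfl) 5 1 → (d 239 dvd_rfl).kolyvaginClass (p := 5) (by norm_num) 1 ≠ 0 := by
  haveI := isElliptic_c944e1
  haveI := isGloballyMinimal_c944e1
  haveI : NeZero (((⟨0, 0, 0, -19, 34⟩ : WeierstrassCurve ℤ).map (Int.castRingHom ℚ)).conductorNorm ℤ) := neZero_conductorNorm_of_isElliptic _
  intro Dt β ι d hcert
  haveI := Fact.mk (by norm_num : Nat.Prime 5)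
  exact kolyvaginClass_ne_zero_of_intModel_certificate_of_tower intModel 5 (by norm_num) hasSurjectiveModNGaloisRep_5 K hK
    hD (by norm_num) heegner_neg31 239 (by norm_num) (by norm_num) (by decide +kernel) (by norm_num) (by norm_num) (by norm_num) (by norm_num)
    (n := 255) card_239 (by norm_num) Dt β ι d hcert

end C944e1
namespace C997b1

/-- **Row `997b1` `(5, -52, 199)`, point-certificate form:** for a tower `d m` (`m ∣ 199`) on a frame,
`P(199) ∉ 5·E(K[199])` ⟹ `c_1(199) ≠ 0`, the bit of `C997b1.depthRow_5_neg52_199` (side conditions: row files).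
[cite: JetchevLauterStein2009, §3.2 and §3.6 (arXiv:0707.0032)] [cite: McCallumLMS1991, §4 Cor. 4.5] -/
theorem kolyvaginClass_ne_zero_of_tower (K : Type) [Field K] [NumberField K]
    (hK : IsImaginaryQuadratic K) (hD : NumberField.discr K = -52) :
    haveI := isElliptic_c997b1;
    haveI := isGloballyMinimal_c997b1;
    haveI : NeZero (((⟨0, -1, 1, -5, -3⟩ : WeierstrassCurve ℤ).map (Int.castRingHom ℚ)).conductorNorm ℤ) := neZero_conductorNorm_of_isElliptic _;
    ∀ (Dt : ModularParametrizationData ((⟨0, -1, 1, -5, -3⟩ : WeierstrassCurve ℤ).map (Int.castRingHom ℚ)) (((⟨0, -1, 1, -5, -3⟩ : WeierstrassCurve ℤ).map (Int.castRingHom ℚ)).conductorNorm ℤ)) (β : ℤ)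
    (ι : K →+* ℂ) (d : (m : ℕ) → m ∣ 199 → KolyvaginHeegnerData Dt β ι m),
    ¬ Koly.PDiv (d 199 dvd_rfl) 5 1 → (d 199 dvd_rfl).kolyvaginClass (p := 5) (by norm_num) 1 ≠ 0 := by
  haveI := isElliptic_c997b1
  haveI := isGloballyMinimal_c997b1
  haveI : NeZero (((⟨0, -1, 1, -5, -3⟩ : WeierstrassCurve ℤ).map (Int.castRingHom ℚ)).conductorNorm ℤ) := neZero_conductorNorm_of_isElliptic _
  intro Dt β ι d hcert
  haveI := Fact.mk (by norm_num : Nat.Prime 5)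
  exact kolyvaginClass_ne_zero_of_intModel_certificate_of_tower intModel 5 (by norm_num) hasSurjectiveModNGaloisRep_5 K hK
    hD (by norm_num) heegner_neg52 199 (by norm_num) (by norm_num) (by decide +kernel) (by norm_num) (by norm_num) (by norm_num) (by norm_num)
    (n := 205) card_199 (by norm_num) Dt β ι d hcert

end C997b1
namespace C997c1

/-- **Row `997c1` `(5, -67, 229)`, point-certificate form:** for a tower `d m` (`m ∣ 229`) on a frame,
`P(229) ∉ 5·E(K[229])` ⟹ `c_1(229) ≠ 0`, the bit of `C997c1.depthRow_5_neg67_229` (side conditions: row files).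
[cite: JetchevLauterStein2009, §3.2 and §3.6 (arXiv:0707.0032)] [cite: McCallumLMS1991, §4 Cor. 4.5] -/
theorem kolyvaginClass_ne_zero_of_tower (K : Type) [Field K] [NumberField K]
    (hK : IsImaginaryQuadratic K) (hD : NumberField.discr K = -67) :
    haveI := isElliptic_c997c1;
    haveI := isGloballyMinimal_c997c1;
    haveI : NeZero (((⟨0, -1, 1, -24, 54⟩ : WeierstrassCurve ℤ).map (Int.castRingHom ℚ)).conductorNorm ℤ) := neZero_conductorNorm_of_isElliptic _;
    ∀ (Dt : ModularParametrizationData ((⟨0, -1, 1, -24, 54⟩ : WeierstrassCurve ℤ).map (Int.castRingHom ℚ)) (((⟨0, -1, 1, -24, 54⟩ : WeierstrassCurve ℤ).map (Int.castRingHom ℚ)).conductorNorm ℤ)) (β : ℤ)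
    (ι : K →+* ℂ) (d : (m : ℕ) → m ∣ 229 → KolyvaginHeegnerData Dt β ι m),
    ¬ Koly.PDiv (d 229 dvd_rfl) 5 1 → (d 229 dvd_rfl).kolyvaginClass (p := 5) (by norm_num) 1 ≠ 0 := by
  haveI := isElliptic_c997c1
  haveI := isGloballyMinimal_c997c1
  haveI : NeZero (((⟨0, -1, 1, -24, 54⟩ : WeierstrassCurve ℤ).map (Int.castRingHom ℚ)).conductorNorm ℤ) := neZero_conductorNorm_of_isElliptic _
  intro Dt β ι d hcert
  haveI := Fact.mk (by norm_num : Nat.Prime 5)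
  exact kolyvaginClass_ne_zero_of_intModel_certificate_of_tower intModel 5 (by norm_num) hasSurjectiveModNGaloisRep_5 K hK
    hD (by norm_num) heegner_neg67 229 (by norm_num) (by norm_num) (by decide +kernel) (by norm_num) (by norm_num) (by norm_num) (by norm_num)
    (n := 255) card_229 (by norm_num) Dt β ι d hcert

end C997c1

end Summit.BirchSwinnertonDyer.BirchSwinnertonDyer.Theorems.KolyvaginDepthDoor

end
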